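/-
Copyright: cell pub-balaban-gaps (YM BLITZ Y1, track G1), seat g1-p2 GEN 7 (unit `pub-balaban-gaps-g1-p2`).  Row (D4) NODE O,
OBJECT level: the EXPONENTIAL WINDOW — print's (3.37) letters on the background field `A` (`|A| < α₁(Lʲη)⁻¹`, `|∇A| < α₁(Lʲη)⁻²`)
turned into the two transporter letters of `D4WalkBlockTransportWindows` for `U′ = e^{X}`, `X = iηA(b)`: `‖e^{X} − 1‖ ≤ e^{‖X‖} − 1`
and the Lipschitz bound `‖e^{X} − e^{Y}‖ ≤ ‖X − Y‖e^{max(‖X‖,‖Y‖)}` in the row-sum (`ℓ^∞`-operator) norm of `Matrix (Fin N) (Fin N) ℂ`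
(column sums via the transpose); Cor. 3.5's step for `U = e^{X}` is in `D4WalkBlockExpTransport`.  (Pure algebra ∕ analysis: imports only
`D4WalkBlockTransportAlgebra` and Mathlib's matrix exponential.)  HONEST FRAMING: (D4) instance 0∕1; NOT BetaPertH, NOT continuum, NOT Clay.
-/
import Summits.QuantumFields.BalabanUV.Gaps.D4WalkBlockTransportAlgebra
import Mathlib.Analysis.Normed.Algebra.MatrixExponential
import Mathlib.Analysis.SpecialFunctions.Exponential
import Literature.Analysis.Calculus.ExpDuhamel

/-!
# `Gaps.D4WalkBlockExpWindow` — the exponential window: (3.37) letters on the background field give the transporter letters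
# (cell pub-balaban-gaps, seat g1-p2 gen 7)

HONEST DEPENDENCY (cell pub-balaban, verbatim): continuum YM on T⁴ ⇐ BetaPertH ∧ nine spine estimates (0/9 proved);
BetaPertH ⇐ (D1) ∧ (D4) ∧ CAP+tail.

* §1 `norm_pow_sub_pow_le`, `norm_exp_sub_exp_le` (`‖e^{x} − e^{y}‖ ≤ ‖x − y‖e^{M}`) in a complete normed `ℂ`-algebra (series proof;
  `‖e^{x} − 1‖ ≤ e^{‖x‖} − 1` is the tree's `Literature.Analysis.Calculus.norm_exp_sub_one_le`).
* §2 the same in the `ℓ^∞`-operator norm of `Matrix (Fin N) (Fin N) ℂ`, read as ROW-SUM and (via the transpose) COLUMN-SUM letters: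
  `rowSumNorm_exp_sub_one_le`, `colSumNorm_exp_sub_one_le`, `rowSumNorm_exp_sub_exp_le`, `colSumNorm_exp_sub_exp_le`.
* §3 `exp_sub_one_le_eps` (`e^{ηa} − 1 ≤ η·ae^{a}` for `η ≤ 1`).
* (§4, the END for `U = e^{X}`, is `D4WalkBlockExpTransport.blockWalkExpansion_expTransport_oneScaleTorus`.)
References: T. Bałaban, Comm. Math. Phys. **99** (1985) 389–434 [B9], (3.37) p. 396, (3.50)–(3.54) pp. 400–401, Cor. 3.5 p. 407.
-/

noncomputable section

namespace Summit.QuantumFields.BalabanUV.Gaps.D4WalkBlockExpWindow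

open Metric Set Finset NormedSpace
open scoped Matrix NNReal
open Summit.QuantumFields.BalabanUV.Gaps.D4WalkBlockTransportAlgebra (conjOp rowSumNorm colSumNorm)

/-! ## §1. The Lipschitz bound of the exponential in a complete normed algebra -/

section Generic

variable {𝔸 : Type*} [NormedRing 𝔸]

/-- `‖xⁿ⁺¹ − yⁿ⁺¹‖ ≤ (n + 1)‖x − y‖Mⁿ` for `‖x‖, ‖y‖ ≤ M` (non-commutative telescoping). -/
theorem norm_pow_sub_pow_le (x y : 𝔸) {M : ℝ} (hx : ‖x‖ ≤ M) (hy : ‖y‖ ≤ M) :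
    ∀ n : ℕ, ‖x ^ (n + 1) - y ^ (n + 1)‖ ≤ (n + 1) * ‖x - y‖ * M ^ n := by
  have hM : 0 ≤ M := (norm_nonneg x).trans hx
  intro n
  induction n with
  | zero => simp
  | succ n ih =>
      have e : x ^ (n + 2) - y ^ (n + 2) = x * (x ^ (n + 1) - y ^ (n + 1)) + (x - y) * y ^ (n + 1) := by
        simp only [pow_succ', mul_sub, sub_mul]; abel
      rw [e]
      calc ‖x * (x ^ (n + 1) - y ^ (n + 1)) + (x - y) * y ^ (n + 1)‖
          ≤ ‖x‖ * ‖x ^ (n + 1) - y ^ (n + 1)‖ + ‖x - y‖ * ‖y ^ (n + 1)‖ :=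
            (norm_add_le _ _).trans (add_le_add (norm_mul_le _ _) (norm_mul_le _ _))
        _ ≤ M * ((n + 1) * ‖x - y‖ * M ^ n) + ‖x - y‖ * M ^ (n + 1) := by
            refine add_le_add (mul_le_mul hx ih (norm_nonneg _) hM)
              (mul_le_mul_of_nonneg_left ((norm_pow_le' y (Nat.succ_pos n)).trans
                (pow_le_pow_left₀ (norm_nonneg _) hy _)) (norm_nonneg _))
        _ = ((n + 1 : ℕ) + 1) * ‖x - y‖ * M ^ (n + 1) := by push_cast; ring

variable [NormedAlgebra ℂ 𝔸] [CompleteSpace 𝔸]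

/-- **Lipschitz bound of the exponential**: `‖exp x − exp y‖ ≤ ‖x − y‖·e^{M}` for `‖x‖, ‖y‖ ≤ M`. -/
theorem norm_exp_sub_exp_le (x y : 𝔸) {M : ℝ} (hx : ‖x‖ ≤ M) (hy : ‖y‖ ≤ M) :
    ‖exp x - exp y‖ ≤ ‖x - y‖ * Real.exp M := by
  have hsx : Summable (fun n : ℕ => ((n.factorial : ℂ)⁻¹) • x ^ n) := expSeries_summable' (𝕂 := ℂ) x
  have hsy : Summable (fun n : ℕ => ((n.factorial : ℂ)⁻¹) • y ^ n) := expSeries_summable' (𝕂 := ℂ) y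
  have hdiff : exp x - exp y = ∑' n : ℕ, ((n.factorial : ℂ)⁻¹) • (x ^ n - y ^ n) := by
    rw [congrFun (exp_eq_tsum ℂ (𝔸 := 𝔸)) x, congrFun (exp_eq_tsum ℂ (𝔸 := 𝔸)) y, ← hsx.tsum_sub hsy]
    exact tsum_congr fun n => by rw [smul_sub]
  have hmaj : Summable (fun n : ℕ => ‖x - y‖ * (M ^ n / (n.factorial : ℝ))) :=
    (Real.summable_pow_div_factorial M).mul_left _
  have hbound : ∀ n : ℕ, ‖((n.factorial : ℂ)⁻¹) • (x ^ n - y ^ n)‖ ≤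
      (fun n : ℕ => match n with | 0 => 0 | k + 1 => ‖x - y‖ * (M ^ k / (k.factorial : ℝ))) n := by
    intro n
    cases n with
    | zero => simp
    | succ k =>
        rw [norm_smul, norm_inv, Complex.norm_natCast]
        have h := norm_pow_sub_pow_le x y hx hy k
        have hf : (0 : ℝ) < ((k + 1).factorial : ℝ) := by exact_mod_cast Nat.factorial_pos _
        rw [inv_mul_le_iff₀ hf, Nat.factorial_succ]
        push_cast
        have : ((k : ℝ) + 1) * (k.factorial : ℝ) * (‖x - y‖ * (M ^ k / (k.factorial : ℝ))) =
            (k + 1) * ‖x - y‖ * M ^ k := by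
          field_simp
        rw [this]; exact h
  have hsm : Summable (fun n : ℕ =>
      (fun n : ℕ => match n with | 0 => (0:ℝ) | k + 1 => ‖x - y‖ * (M ^ k / (k.factorial : ℝ))) n) := by
    rw [← summable_nat_add_iff 1]
    exact hmaj
  rw [hdiff]
  have hsN : Summable (fun n : ℕ => ‖((n.factorial : ℂ)⁻¹) • (x ^ n - y ^ n)‖) :=
    Summable.of_nonneg_of_le (fun _ => norm_nonneg _) hbound hsm
  refine (norm_tsum_le_tsum_norm hsN).trans ((Summable.tsum_le_tsum hbound hsN hsm).trans (le_of_eq ?_))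
  rw [hsm.tsum_eq_zero_add]
  simp only [zero_add]
  rw [tsum_mul_left, Real.exp_eq_exp_ℝ, congrFun (exp_eq_tsum_div (𝔸 := ℝ)) M]

end Generic

/-! ## §2. Row-sum and column-sum letters for `e^{X} − 1` and `e^{X} − e^{Y}` on `Matrix (Fin N) (Fin N) ℂ` -/

section MatrixExp

open scoped Matrix.Norms.Operator

variable {N : ℕ}

/-- Each row sum is bounded by the `ℓ^∞`-operator norm. -/
theorem rowSumNorm_le_norm (M : Matrix (Fin N) (Fin N) ℂ) (a : Fin N) : rowSumNorm M a ≤ ‖M‖ := by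
  rw [Matrix.linfty_opNorm_def]
  have h : (∑ j, ‖M a j‖₊ : ℝ≥0) ≤ univ.sup (fun i => ∑ j, ‖M i j‖₊) :=
    Finset.le_sup (f := fun i => ∑ j, ‖M i j‖₊) (mem_univ a)
  have h' := NNReal.coe_le_coe.2 h
  simp only [NNReal.coe_sum, coe_nnnorm] at h'
  exact h'

/-- The `ℓ^∞`-operator norm is bounded by a common bound on the row sums. -/
theorem norm_le_of_rowSumNorm (M : Matrix (Fin N) (Fin N) ℂ) {s : ℝ} (hs : 0 ≤ s)
    (h : ∀ a, rowSumNorm M a ≤ s) : ‖M‖ ≤ s := by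
  rw [Matrix.linfty_opNorm_def, ← Real.coe_toNNReal s hs, NNReal.coe_le_coe]
  refine Finset.sup_le fun i _ => ?_
  rw [← NNReal.coe_le_coe, Real.coe_toNNReal s hs]
  simp only [NNReal.coe_sum, coe_nnnorm]
  exact h i

/-- Column sums are row sums of the transpose. -/
theorem colSumNorm_eq_transpose (M : Matrix (Fin N) (Fin N) ℂ) (b : Fin N) :
    colSumNorm M b = rowSumNorm Mᵀ b := rfl

/-- Row sums are invariant under negation. -/
theorem rowSumNorm_neg (M : Matrix (Fin N) (Fin N) ℂ) (a : Fin N) : rowSumNorm (-M) a = rowSumNorm M a := by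
  simp [rowSumNorm]

/-- Column sums are invariant under negation. -/
theorem colSumNorm_neg (M : Matrix (Fin N) (Fin N) ℂ) (b : Fin N) : colSumNorm (-M) b = colSumNorm M b := by
  simp [colSumNorm]

/-- Transpose of `exp X − 1`. -/
theorem transpose_exp_sub_one (X : Matrix (Fin N) (Fin N) ℂ) : (exp X - 1)ᵀ = exp Xᵀ - 1 := by
  rw [Matrix.transpose_sub, Matrix.transpose_one, Matrix.exp_transpose]

/-- **Bond letter, rows.**  Row sums of `exp X − 1` when all row sums of `X` are `≤ s`: at most `e^{s} − 1`. -/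
theorem rowSumNorm_exp_sub_one_le (X : Matrix (Fin N) (Fin N) ℂ) {s : ℝ} (hs : 0 ≤ s)
    (h : ∀ a, rowSumNorm X a ≤ s) (a : Fin N) : rowSumNorm (exp X - 1) a ≤ Real.exp s - 1 := by
  have hX := norm_le_of_rowSumNorm X hs h
  refine (rowSumNorm_le_norm _ a).trans ((Literature.Analysis.Calculus.norm_exp_sub_one_le X).trans ?_)
  exact sub_le_sub_right (Real.exp_le_exp.2 hX) _

/-- **Bond letter, columns.**  Column sums of `exp X − 1` when all column sums of `X` are `≤ s`. -/
theorem colSumNorm_exp_sub_one_le (X : Matrix (Fin N) (Fin N) ℂ) {s : ℝ} (hs : 0 ≤ s)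
    (h : ∀ b, colSumNorm X b ≤ s) (b : Fin N) : colSumNorm (exp X - 1) b ≤ Real.exp s - 1 := by
  rw [colSumNorm_eq_transpose, transpose_exp_sub_one]
  exact rowSumNorm_exp_sub_one_le Xᵀ hs (fun a => (colSumNorm_eq_transpose X a) ▸ h a) b

/-- **Derivative letter, rows.**  Row sums of `exp X − exp Y`: at most `s′e^{s}` when the row sums of `X`, `Y` are `≤ s` and
those of `X − Y` are `≤ s′`. -/
theorem rowSumNorm_exp_sub_exp_le (X Y : Matrix (Fin N) (Fin N) ℂ) {s s' : ℝ} (hs : 0 ≤ s) (hs' : 0 ≤ s')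
    (hX : ∀ a, rowSumNorm X a ≤ s) (hY : ∀ a, rowSumNorm Y a ≤ s) (hXY : ∀ a, rowSumNorm (X - Y) a ≤ s')
    (a : Fin N) : rowSumNorm (exp X - exp Y) a ≤ s' * Real.exp s := by
  refine (rowSumNorm_le_norm _ a).trans ((norm_exp_sub_exp_le X Y (norm_le_of_rowSumNorm X hs hX)
    (norm_le_of_rowSumNorm Y hs hY)).trans ?_)
  exact mul_le_mul_of_nonneg_right (norm_le_of_rowSumNorm _ hs' hXY) (Real.exp_pos _).le

/-- **Derivative letter, columns.** -/
theorem colSumNorm_exp_sub_exp_le (X Y : Matrix (Fin N) (Fin N) ℂ) {s s' : ℝ} (hs : 0 ≤ s) (hs' : 0 ≤ s')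
    (hX : ∀ b, colSumNorm X b ≤ s) (hY : ∀ b, colSumNorm Y b ≤ s) (hXY : ∀ b, colSumNorm (X - Y) b ≤ s')
    (b : Fin N) : colSumNorm (exp X - exp Y) b ≤ s' * Real.exp s := by
  rw [colSumNorm_eq_transpose, Matrix.transpose_sub, ← Matrix.exp_transpose, ← Matrix.exp_transpose]
  exact rowSumNorm_exp_sub_exp_le Xᵀ Yᵀ hs hs' (fun a => (colSumNorm_eq_transpose X a) ▸ hX a)
    (fun a => (colSumNorm_eq_transpose Y a) ▸ hY a)
    (fun a => by rw [← Matrix.transpose_sub]; exact (colSumNorm_eq_transpose _ a) ▸ hXY a) b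

end MatrixExp

/-! ## §3. Elementary: `e^{ηa} − 1 ≤ η·ae^{a}` -/

/-- The small-field form: `e^{ηa} − 1 ≤ η·(a·e^{a})` for `0 ≤ η ≤ 1`, `0 ≤ a`. -/
theorem exp_sub_one_le_eps {ε a : ℝ} (hε : 0 ≤ ε) (hε1 : ε ≤ 1) (ha : 0 ≤ a) :
    Real.exp (ε * a) - 1 ≤ ε * (a * Real.exp a) := by
  have h1 : Real.exp (ε * a) - 1 ≤ ε * a * Real.exp (ε * a) := by
    have h := Real.add_one_le_exp (-(ε * a))
    have h2 : Real.exp (ε * a) * Real.exp (-(ε * a)) = 1 := by rw [← Real.exp_add, add_neg_cancel, Real.exp_zero]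
    nlinarith [Real.exp_pos (ε * a), Real.exp_pos (-(ε * a))]
  have h2 : Real.exp (ε * a) ≤ Real.exp a := Real.exp_le_exp.2 (by nlinarith)
  calc Real.exp (ε * a) - 1 ≤ ε * a * Real.exp (ε * a) := h1
    _ ≤ ε * (a * Real.exp a) := by
        rw [mul_assoc]; exact mul_le_mul_of_nonneg_left (mul_le_mul_of_nonneg_left h2 ha) hε

end Summit.QuantumFields.BalabanUV.Gaps.D4WalkBlockExpWindow

end
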